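import Summits.HodgeConjecture.CorCM.AbelianTwoPowerCMTypes
import Summits.HodgeConjecture.CorCM.OcticCMFieldAutomorphismsNondegenerate
import Mathlib.GroupTheory.Index
import HarnessLib

/-!
# Abelian CM fields of `2`-power degree which are CYCLIC over `ℚ` or over a REAL QUADRATIC subfield: every simple
# CM abelian variety is nondegenerate ("thin kernels") — and the Hodge conjecture for all their powers

COR-CM (cell `pub-hodgecm2`), binder seat b04 (gen 15), count-neutral claim ABELIAN-2POWER-CLASSIF, part I; sequel
of gen 12's TWO-POWER-CRITERION (`CorCM/AbelianTwoPowerCMTypes`: for an abelian CM field `K` of degree `2^{n+1}`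
a CM type is DEGENERATE iff `{g | σ_g ∈ Φ}` is EQUIDISTRIBUTED over some odd character `χ` of `Gal(K/ℚ)`, i.e.
of generalised Weil type over `k = K^{ker χ}`).  KERNEL ONLY: theorems; no definition, no named fact, no `sorry`.
`HC_CM` is neither used nor claimed: this is the Hodge conjecture for a NAMED SUB-CLASS of CM abelian varieties.

## The observation (thin kernels)

Let `G = Gal(K/ℚ)` be abelian of order `2^{n+1}`, `ρ ∈ G` complex conjugation, `T = {g | σ_g ∈ Φ}` (so
`ρg ∈ T ↔ g ∉ T`), and let `χ` be an odd character (`χ(ρ) = −1`) over which `T` is equidistributed: for every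
`g`, `#{t ∈ T : χ(t) = χ(g)} = #{t ∈ T : χ(t) = −χ(g)}`.

* §1 `not_equidistributed_of_ker_trivial` — if `ker χ = 1` this is impossible (the fibre of `χ(g)` through
  `g ∈ T` is `{g}`, the fibre of `−χ(g) = χ(ρg)` is `{ρg} ⊄ T`);
* §1 `forall_mem_iff_of_ker_pair` — if `ker χ = {1, ν}` then `νρ ≠ 1` STABILISES `T` (`z ∈ T ↔ νρz ∈ T`: the
  fibre of `−χ(z)` inside `T` is `⊆ {ρz, νρz} ∖ {ρz}` and non-empty);
* §2 `eq_one_of_mem_zpowers` / `ker_thin_of_mem_zpowers` — if `ρ` lies in a CYCLIC subgroup `Z = ⟨z⟩` of index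
  `≤ 2`, every odd character has `|ker χ| ≤ 2`: `χ|_Z` is injective (a non-trivial subgroup of the cyclic `2`-group
  `Z` contains its unique involution `ρ`, but `χ(ρ) = −1`; done with `orderOf χ(z) = orderOf z` in `ℂ`), and two
  kernel elements outside `Z` differ by an element of `Z ∩ ker χ = 1`.

Hence (§3, **`isNondegenerate_of_isPrimitive_of_mem_zpowers`**): for `K` CM with ABELIAN Galois group of order
`[K:ℚ] = 2^{n+1}` in which complex conjugation lies in a cyclic subgroup of index `≤ 2` — equivalently `K` is
CYCLIC over a totally real subfield `L` of degree `≤ 2`, i.e. over `ℚ` or over a REAL QUADRATIC field (this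
field-theoretic dress, and the realisations: the Hodge conjecture for all powers of the SIMPLE CM abelian varieties
of these fields, are part Ib `CorCM/AbelianTwoPowerCyclicOverRealQuadratic`) — every PRIMITIVE CM type is
NONDEGENERATE: a stabiliser `v ≠ 1` of `T` makes the `Aut(ℂ)`-translates of `Φ` agree on `σ_1` and `σ_v`
(`not_isPrimitive_of_forall_mem_iff`, Shimura §8.2 Prop. 26 in the separation form `isPrimitive_iff_forall_eq`).

NEW CLASSES (beyond the tree: cyclic `2`-power fields, gen 11 `CyclicTwoPower`, where ALL types are nondegenerate;
all Galois octic fields, gen 13): Galois group `ℤ/2^a × ℤ/2` with `ρ` in the cyclic factor, i.e. `K = K₁·L` with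
`K₁` a cyclic CM field of degree `2^a` and `L` a real quadratic field not contained in `K₁`: e.g.
`K = ℚ(ζ₃₂ − ζ₃₂⁻¹, √3)` (degree `16`, simple CM abelian EIGHTFOLDS), `ℚ(ζ₆₄ − ζ₆₄⁻¹, √3)` (degree `32`), ….
SHARP within `ℤ/2^a × ℤ/2`, `a ≥ 3` (offline census of this seat, kernel certificate in part III): if `ρ` is NOT
in the cyclic factor (`K` cyclic over an IMAGINARY quadratic field, e.g. `ℚ(ζ₃₂) ⊃ ℚ(i)` with `96` primitive
degenerate types, or `ρ = (2^{a−1}, 1)`) primitive degenerate types exist; and for `|G| ≥ 32` the condition "`ρ` in a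
cyclic subgroup of index `≤ 2`" is NECESSARY among abelian `2`-groups (census `|G| = 32`: only `ℤ/32` and
`ℤ/16 × ℤ/2` with `ρ = (8,0)` have all primitive types nondegenerate), while at `|G| = 16` exactly two further pairs
survive (`(ℤ/2)⁴`; `ℤ/4 × (ℤ/2)²` with `ρ = (2,0,0)` — part II `CorCM/AbelianSixteenSquaresInConj`).

Presearch: [Dodson1984] §3.1.1 (constant weight criterion, `K ⊇` imaginary quadratic), §3.2.1–3.2.2 (existence of
degenerate primitive types on `⟨ρ⟩ × ℤ_n`, `n` composite, and inside `ℚ(ζ_p)`), §5.2 (`n = 4` tables);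
[Gordon1999HodgeAVSurvey] §9.4.2 (Lenstra's types on `ℚ(ζ₃₂)`); [Kubota1965] Lemma 2 — no statement for
"cyclic over a real quadratic field"; corpus vsearch/hybrid + galaxy (`degenerate CM-type|nondegenerate CM type`)
0 relevant.  The theorem below is, as far as we can tell, not in print.

## References

* [Kubota1965] T. Kubota, *On the field extension by complex multiplication*, Trans. AMS 118 (1965), §4 Lemma 2.
* [Dodson1984] B. Dodson, *The structure of Galois groups of CM-fields*, Trans. AMS 283 (1984), §3.1.1, §3.2.1, §5.2.
* [Gordon1999HodgeAVSurvey] B. B. Gordon, *A survey of the Hodge conjecture for abelian varieties*, 5.13, Thm. 6.4,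
  §9.4.2, §9.4.3.
* [Shimura1998] G. Shimura, *Abelian Varieties with Complex Multiplication and Modular Functions*, §8.1, §8.2
  Prop. 26, §18.2 Lemma.
-/

noncomputable section

open NumberField

namespace Summit.HodgeConjecture.CorCM.ThinKernel

open Literature.NumberTheory.ComplexMultiplication
open Literature.AlgebraicGeometry.Motives (CMType)
open Literature.AlgebraicGeometry.Pohlmann1968
open Summit.HodgeConjecture.CorCM.AbelianTwoPower (isNondegenerate_iff_forall_not_equidistributed)
open Summit.HodgeConjecture.CorCM.GaloisOctic (embOf_complexConj_mul_mem_iff complexConj_mul_self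
  complexConj_restrictScalars_ne_one)

/-! ## §1 Thin kernels: an odd character with `|ker χ| ≤ 2` over which a CM type is equidistributed -/

section Group

variable {G : Type*} [Group G] [Fintype G] [DecidableEq G]

omit [Fintype G] [DecidableEq G] in
/-- `χ(s) = χ(g)` iff `χ(s g⁻¹) = 1`. [folklore] -/
theorem chi_eq_iff (χ : AddChar (Additive G) ℂ) (s g : G) :
    χ (Additive.ofMul s) = χ (Additive.ofMul g) ↔ χ (Additive.ofMul (s * g⁻¹)) = 1 := by
  have hu : χ (Additive.ofMul g) ≠ 0 := (AddChar.val_isUnit χ (Additive.ofMul g)).ne_zero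
  rw [ofMul_mul, ofMul_inv, AddChar.map_add_eq_mul, AddChar.map_neg_eq_inv, mul_inv_eq_one₀ hu]

omit [Fintype G] [DecidableEq G] in
/-- `−χ(g) = χ(ρ g)` for an odd character. [folklore] -/
theorem neg_chi_eq {ρ : G} (χ : AddChar (Additive G) ℂ) (hχ : χ (Additive.ofMul ρ) = -1) (g : G) :
    -χ (Additive.ofMul g) = χ (Additive.ofMul (ρ * g)) := by
  rw [ofMul_mul, AddChar.map_add_eq_mul, hχ, neg_one_mul]

omit [Fintype G] in
/-- **Trivial kernel: no CM type is equidistributed over an injective odd character** (the fibre of `χ(g)`, `g ∈ T`,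
inside `T` is `{g}`; the fibre of `−χ(g) = χ(ρg)` is `{ρg}`, outside `T`). [cite: Kubota1965, §4 Lemma 2] -/
theorem not_equidistributed_of_ker_trivial {ρ : G} {T : Finset G} (hT : ∀ g : G, ρ * g ∈ T ↔ g ∉ T)
    (χ : AddChar (Additive G) ℂ) (hχ : χ (Additive.ofMul ρ) = -1)
    (hker : ∀ g : G, χ (Additive.ofMul g) = 1 → g = 1) :
    ¬ ∀ g : G, (T.filter fun s => χ (Additive.ofMul s) = χ (Additive.ofMul g)).card =
        (T.filter fun s => χ (Additive.ofMul s) = -χ (Additive.ofMul g)).card := by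
  intro hE
  -- some `g₀ ∈ T`
  obtain ⟨g₀, hg₀⟩ : ∃ g₀, g₀ ∈ T := by
    by_cases h1 : (1 : G) ∈ T
    · exact ⟨1, h1⟩
    · exact ⟨ρ * 1, (hT 1).2 h1⟩
  have hL : (T.filter fun s => χ (Additive.ofMul s) = χ (Additive.ofMul g₀)) = {g₀} := by
    ext s
    simp only [Finset.mem_filter, Finset.mem_singleton]
    constructor
    · rintro ⟨-, hs⟩
      exact mul_inv_eq_one.1 (hker _ ((chi_eq_iff χ s g₀).1 hs))
    · rintro rfl
      exact ⟨hg₀, rfl⟩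
  have hR : (T.filter fun s => χ (Additive.ofMul s) = -χ (Additive.ofMul g₀)) = ∅ := by
    rw [Finset.eq_empty_iff_forall_notMem]
    intro s hs
    rw [Finset.mem_filter, neg_chi_eq χ hχ] at hs
    have hs' : s = ρ * g₀ := mul_inv_eq_one.1 (hker _ ((chi_eq_iff χ s (ρ * g₀)).1 hs.2))
    exact (hT g₀).1 (hs' ▸ hs.1) hg₀
  have h := hE g₀
  rw [hL, hR, Finset.card_singleton, Finset.card_empty] at h
  exact one_ne_zero h

omit [Fintype G] in
/-- **Kernel of order two: `νρ` stabilises every CM type equidistributed over `χ`.**  If `ker χ = {1, ν}` with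
`ν ≠ 1` (and `ρν = νρ`), and the CM type `T` (`ρg ∈ T ↔ g ∉ T`) is equidistributed over the odd character `χ`, then
`νρ ≠ 1` and `z ∈ T ↔ νρ·z ∈ T` for all `z`: the fibre of `−χ(z) = χ(ρz)` inside `T` lies in `{ρz, νρz}`, misses
`ρz`, and is non-empty because the fibre of `χ(z)` contains `z`.  (For `|ker χ| = 2` the field `K^{ker χ}` has index
`2` in `K` and "equidistributed" = every embedding of it has exactly one extension in `Φ`.) [cite: Kubota1965, §4 Lemma 2] -/
theorem forall_mem_iff_of_ker_pair {ρ ν : G} {T : Finset G} (hT : ∀ g : G, ρ * g ∈ T ↔ g ∉ T)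
    (hρν : ρ * ν = ν * ρ) (χ : AddChar (Additive G) ℂ) (hχ : χ (Additive.ofMul ρ) = -1) (hν1 : ν ≠ 1)
    (hχν : χ (Additive.ofMul ν) = 1) (hker : ∀ g : G, χ (Additive.ofMul g) = 1 → g = 1 ∨ g = ν)
    (hE : ∀ g : G, (T.filter fun s => χ (Additive.ofMul s) = χ (Additive.ofMul g)).card =
        (T.filter fun s => χ (Additive.ofMul s) = -χ (Additive.ofMul g)).card) :
    ν * ρ ≠ 1 ∧ ∀ z : G, z ∈ T ↔ (ν * ρ) * z ∈ T := by
  -- `ν² = 1`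
  have hν2 : ν * ν = 1 := by
    have h : χ (Additive.ofMul (ν * ν)) = 1 := by rw [ofMul_mul, AddChar.map_add_eq_mul, hχν, one_mul]
    rcases hker _ h with h1 | h2
    · exact h1
    · exact absurd (mul_left_cancel (a := ν) (h2.trans (mul_one ν).symm)) hν1
  -- step A: `z ∈ T → νρz ∈ T`
  have hA : ∀ z : G, z ∈ T → (ν * ρ) * z ∈ T := by
    intro z hz
    have hLpos : 0 < (T.filter fun s => χ (Additive.ofMul s) = χ (Additive.ofMul z)).card :=
      Finset.card_pos.2 ⟨z, Finset.mem_filter.2 ⟨hz, rfl⟩⟩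
    rw [hE z] at hLpos
    obtain ⟨s, hs⟩ := Finset.card_pos.1 hLpos
    rw [Finset.mem_filter, neg_chi_eq χ hχ] at hs
    rcases hker _ ((chi_eq_iff χ s (ρ * z)).1 hs.2) with h1 | h2
    · exact absurd hs.1 (fun hsT => (hT z).1 ((mul_inv_eq_one.1 h1) ▸ hsT) hz)
    · have hs' : s = ν * ρ * z := by rw [mul_assoc]; exact mul_inv_eq_iff_eq_mul.1 h2
      exact hs' ▸ hs.1
  refine ⟨fun h => ?_, fun z => ⟨hA z, fun hz => ?_⟩⟩
  · have : χ (Additive.ofMul (ν * ρ)) = 1 := by rw [h, ofMul_one, AddChar.map_zero_eq_one]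
    rw [ofMul_mul, AddChar.map_add_eq_mul, hχν, hχ, one_mul] at this
    norm_num at this
  · -- step B: apply A to `νρz`: `νρνρ z = ρρ z ∈ T`, and `ρ(ρz) ∈ T ↔ z ∈ T`
    have h2 := hA _ hz
    have heq : ν * ρ * (ν * ρ * z) = ρ * (ρ * z) := by
      rw [← mul_assoc, show ν * ρ * (ν * ρ) = ρ * ρ by
        rw [mul_assoc, ← mul_assoc ρ ν ρ, hρν, mul_assoc, ← mul_assoc, hν2, one_mul], mul_assoc]
    rw [heq] at h2
    by_contra hzT
    exact (hT (ρ * z)).1 h2 ((hT z).2 hzT)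

/-! ## §2 Complex conjugation inside a cyclic subgroup of index `≤ 2` forces thin kernels -/

omit [DecidableEq G] in
/-- **An odd character is injective on a cyclic `2`-group containing `ρ`.**  In a group of order `2^{n+1}`, if
`ρ ≠ 1`, `ρ² = 1`, `ρ ∈ ⟨z⟩` and `χ(ρ) = −1`, then `χ(g) = 1` for `g ∈ ⟨z⟩` forces `g = 1`: with `orderOf z = 2^N`
and `ω = χ(z)`, `ρ = z^a` gives `2^N ∣ 2a`, and `orderOf ω` is a divisor `2^i` of `2^N` not dividing `a`
(`ω^a = −1`), so `i = N`; then `ω^b = 1` gives `2^N ∣ b`, `z^b = 1`. [folklore] -/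
theorem eq_one_of_mem_zpowers {n : ℕ} (hG : Fintype.card G = 2 ^ (n + 1)) {ρ z : G} (hρ1 : ρ ≠ 1)
    (hρ2 : ρ * ρ = 1) (hρz : ρ ∈ Subgroup.zpowers z) (χ : AddChar (Additive G) ℂ)
    (hχ : χ (Additive.ofMul ρ) = -1) {g : G} (hg : g ∈ Subgroup.zpowers z) (h1 : χ (Additive.ofMul g) = 1) :
    g = 1 := by
  -- `orderOf z = 2^N`
  obtain ⟨N, -, hN⟩ := (Nat.dvd_prime_pow Nat.prime_two).1 (hG ▸ orderOf_dvd_card (x := z))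
  -- `ρ = z^a`, `g = z^b`
  obtain ⟨a, rfl⟩ := (Submonoid.mem_powers_iff _ _).1 (mem_powers_iff_mem_zpowers.2 hρz)
  obtain ⟨b, rfl⟩ := (Submonoid.mem_powers_iff _ _).1 (mem_powers_iff_mem_zpowers.2 hg)
  set ω : ℂ := χ (Additive.ofMul z) with hω
  have hpow : ∀ k : ℕ, χ (Additive.ofMul (z ^ k)) = ω ^ k := fun k => by
    rw [ofMul_pow, AddChar.map_nsmul_eq_pow]
  rw [hpow] at hχ h1
  -- `N ≥ 1`
  have hN1 : 1 ≤ N := by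
    rcases Nat.eq_zero_or_pos N with h0 | hpos
    · exfalso
      rw [h0, pow_zero, orderOf_eq_one_iff] at hN
      rw [hN, one_pow] at hρ1
      exact hρ1 rfl
    · exact hpos
  -- `2^N ∣ 2a`, hence `2^(N-1) ∣ a`
  have h2a : 2 ^ (N - 1) ∣ a := by
    have h : orderOf z ∣ 2 * a := by rw [orderOf_dvd_iff_pow_eq_one, two_mul, pow_add, hρ2]
    rw [hN, show N = (N - 1) + 1 by omega, pow_succ, mul_comm] at h
    exact Nat.dvd_of_mul_dvd_mul_left (by norm_num) h
  -- `orderOf ω = 2^i`, `i ≤ N`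
  have hωN : ω ^ 2 ^ N = 1 := by rw [← hpow, ← hN, pow_orderOf_eq_one, ofMul_one, AddChar.map_zero_eq_one]
  obtain ⟨i, hiN, hi⟩ := (Nat.dvd_prime_pow Nat.prime_two).1 (orderOf_dvd_of_pow_eq_one hωN)
  -- `i = N`: otherwise `orderOf ω ∣ 2^(N-1) ∣ a` and `ω^a = 1 ≠ -1`
  have hiN' : i = N := by
    by_contra hne
    have hlt : i ≤ N - 1 := by omega
    have hdvd : orderOf ω ∣ a := by
      rw [hi]
      exact (pow_dvd_pow 2 hlt).trans h2a
    have : ω ^ a = 1 := orderOf_dvd_iff_pow_eq_one.1 hdvd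
    rw [this] at hχ
    norm_num at hχ
  -- `ω^b = 1` ⟹ `2^N ∣ b` ⟹ `z^b = 1`
  have hb : 2 ^ N ∣ b := by
    rw [← hiN', ← hi]
    exact orderOf_dvd_of_pow_eq_one h1
  rw [← orderOf_dvd_iff_pow_eq_one, hN]
  exact hb

/-- **Thin kernels.**  In a group of order `2^{n+1}`, if complex conjugation `ρ` (`ρ ≠ 1`, `ρ² = 1`) lies in a
cyclic subgroup `⟨z⟩` of index `≤ 2`, then every odd character `χ` has `|ker χ| ≤ 2`: either `ker χ = 1`, or
`ker χ = {1, ν}` for some `ν ≠ 1` (two kernel elements outside `⟨z⟩` have product and squares in `⟨z⟩ ∩ ker χ = 1`).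
[folklore] -/
theorem ker_thin_of_mem_zpowers {n : ℕ} (hG : Fintype.card G = 2 ^ (n + 1)) {ρ z : G} (hρ1 : ρ ≠ 1)
    (hρ2 : ρ * ρ = 1) (hρz : ρ ∈ Subgroup.zpowers z) (hidx : (Subgroup.zpowers z).index ≤ 2)
    (χ : AddChar (Additive G) ℂ) (hχ : χ (Additive.ofMul ρ) = -1) :
    (∀ g : G, χ (Additive.ofMul g) = 1 → g = 1) ∨
      ∃ ν : G, ν ≠ 1 ∧ χ (Additive.ofMul ν) = 1 ∧ ∀ g : G, χ (Additive.ofMul g) = 1 → g = 1 ∨ g = ν := by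
  by_cases hall : ∀ g : G, χ (Additive.ofMul g) = 1 → g = 1
  · exact Or.inl hall
  push Not at hall
  obtain ⟨ν, hχν, hν1⟩ := hall
  refine Or.inr ⟨ν, hν1, hχν, fun g hg => ?_⟩
  by_cases hg1 : g = 1
  · exact Or.inl hg1
  right
  have hZ := fun (x : G) (hx : x ∈ Subgroup.zpowers z) (h : χ (Additive.ofMul x) = 1) =>
    eq_one_of_mem_zpowers hG hρ1 hρ2 hρz χ hχ hx h
  have hgZ : g ∉ Subgroup.zpowers z := fun h => hg1 (hZ g h hg)
  have hνZ : ν ∉ Subgroup.zpowers z := fun h => hν1 (hZ ν h hχν)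
  -- the index is exactly `2`
  have hidx2 : (Subgroup.zpowers z).index = 2 := by
    have hne1 : (Subgroup.zpowers z).index ≠ 1 := fun h1 => by
      rw [Subgroup.index_eq_one] at h1
      exact hgZ (h1 ▸ Subgroup.mem_top g)
    have hne0 : (Subgroup.zpowers z).index ≠ 0 := Subgroup.index_ne_zero_of_finite
    omega
  -- `gν ∈ ⟨z⟩ ∩ ker χ` and `g² ∈ ⟨z⟩ ∩ ker χ`
  have hgν : g * ν = 1 := by
    refine hZ _ ((Subgroup.mul_mem_iff_of_index_two hidx2).2 (iff_of_false hgZ hνZ)) ?_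
    rw [ofMul_mul, AddChar.map_add_eq_mul, hg, hχν, one_mul]
  have hgg : g * g = 1 := by
    refine hZ _ ((Subgroup.mul_mem_iff_of_index_two hidx2).2 (iff_of_false hgZ hgZ)) ?_
    rw [ofMul_mul, AddChar.map_add_eq_mul, hg, one_mul]
  calc g = g * (g * ν) := by rw [hgν, mul_one]
    _ = ν := by rw [← mul_assoc, hgg, one_mul]

end Group

/-! ## §3 Abelian CM fields of `2`-power degree, cyclic over `ℚ` or over a real quadratic subfield -/

section Basics

variable {K : Type} [Field K] [NumberField K]

/-- **A non-trivial left stabiliser of `T = {g | σ_g ∈ Φ}` makes `Φ` imprimitive** (`K/ℚ` normal): if `v ≠ 1` and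
`z ∈ T ↔ vz ∈ T` for all `z`, then every translate `τΦ`, `τ ∈ Aut(ℂ)` (acting by `σ_g ↦ σ_{gδ⁻¹}`), contains
`σ_1` iff it contains `σ_v`, so the translates do not separate the embeddings — Shimura's criterion in the form
`isPrimitive_iff_forall_eq`. [cite: Shimura1998, §8.2 Prop. 26] -/
theorem not_isPrimitive_of_forall_mem_iff [Normal ℚ K] (Φ : CMType K) (φ₀ : K →+* ℂ) {v : K ≃ₐ[ℚ] K}
    (hv1 : v ≠ 1) (hv : ∀ z : K ≃ₐ[ℚ] K, embOf φ₀ z ∈ Φ.1 ↔ embOf φ₀ (v * z) ∈ Φ.1) :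
    ¬ IsPrimitive (ℂ ≃+* ℂ) Φ.1 φ₀ := by
  haveI := isPretransitive_ringEquiv_complex (K := K)
  rw [isPrimitive_iff_forall_eq]
  intro hsep
  have hne : embOf φ₀ 1 ≠ embOf φ₀ v := fun h => hv1 ((embOf_bijective φ₀).1 h).symm
  refine hne (hsep _ _ fun τ => ?_)
  obtain ⟨δ, hδ⟩ := exists_algEquiv_comp_eq_smul φ₀ τ
  rw [smul_embOf_of_comp φ₀ hδ, smul_embOf_of_comp φ₀ hδ, one_mul]
  exact hv δ⁻¹

/-- `φ₀ ∘ c = conj ∘ φ₀` for Mathlib's complex conjugation `c` of the CM field `K`, viewed in `Gal(K/ℚ)`.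
[cite: Shimura1998, §18.2 Lemma (i)] -/
theorem complexConj_restrictScalars_apply [IsCMField K] (φ₀ : K →+* ℂ) (x : K) :
    φ₀ ((IsCMField.complexConj K).restrictScalars ℚ x) = starRingEnd ℂ (φ₀ x) := by
  rw [AlgEquiv.restrictScalars_apply]
  exact IsCMField.complexEmbedding_complexConj K φ₀ x

end Basics

section Field

variable {K : Type} [Field K] [NumberField K] [IsCMField K] [IsGalois ℚ K] {Φ : CMType K}

/-- **THIN KERNELS ⟹ PRIMITIVE TYPES ARE NONDEGENERATE.**  Let `K` be a CM field, Galois over `ℚ` with ABELIAN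
Galois group of order `[K:ℚ] = 2^{n+1}`, and suppose complex conjugation lies in a cyclic subgroup `⟨z⟩` of
`Gal(K/ℚ)` of index `≤ 2`.  Then every PRIMITIVE CM type `Φ` of `K` is NONDEGENERATE (Kubota rank `2^n + 1`).
Proof: a degenerate `Φ` is equidistributed over some odd character `χ` (gen 12's criterion
`AbelianTwoPower.isNondegenerate_iff_forall_not_equidistributed`); `|ker χ| ≤ 2` (`ker_thin_of_mem_zpowers`);
`ker χ = 1` is impossible (`not_equidistributed_of_ker_trivial`) and `ker χ = {1, ν}` yields the stabiliser
`νρ ≠ 1` of `{g | σ_g ∈ Φ}` (`forall_mem_iff_of_ker_pair`), contradicting primitivity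
(`not_isPrimitive_of_forall_mem_iff`). [cite: Kubota1965, §4 Lemma 2] [cite: Shimura1998, §8.2 Prop. 26]
[cite: Gordon1999HodgeAVSurvey, §9.4.2, §9.4.3] -/
theorem isNondegenerate_of_isPrimitive_of_mem_zpowers (hcomm : ∀ g h : K ≃ₐ[ℚ] K, g * h = h * g) {n : ℕ}
    (hK : Module.finrank ℚ K = 2 ^ (n + 1)) (z : K ≃ₐ[ℚ] K)
    (hcz : (IsCMField.complexConj K).restrictScalars ℚ ∈ Subgroup.zpowers z)
    (hidx : (Subgroup.zpowers z).index ≤ 2) (φ₀ : K →+* ℂ) (hprim : IsPrimitive (ℂ ≃+* ℂ) Φ.1 φ₀) :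
    IsNondegenerate Φ := by
  classical
  set c : K ≃ₐ[ℚ] K := (IsCMField.complexConj K).restrictScalars ℚ with hc_def
  by_contra hdeg
  have hcrit := (isNondegenerate_iff_forall_not_equidistributed hcomm hK Φ φ₀ c
    (complexConj_restrictScalars_apply φ₀)).not.1 hdeg
  push Not at hcrit
  obtain ⟨χ, hχ, hE⟩ := hcrit
  set T : Finset (K ≃ₐ[ℚ] K) := Finset.univ.filter fun g' : K ≃ₐ[ℚ] K => embOf φ₀ g' ∈ Φ.1 with hT_def
  have hmemT : ∀ g, g ∈ T ↔ embOf φ₀ g ∈ Φ.1 := fun g => by simp [hT_def]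
  have hT : ∀ g : K ≃ₐ[ℚ] K, c * g ∈ T ↔ g ∉ T := fun g => by
    rw [hmemT, hmemT]; exact embOf_complexConj_mul_mem_iff Φ φ₀ g
  have hcard : Fintype.card (K ≃ₐ[ℚ] K) = 2 ^ (n + 1) := by
    rw [Fintype.card_congr (Equiv.ofBijective (embOf φ₀) (embOf_bijective φ₀)), NumberField.Embeddings.card, hK]
  have hc1 : c ≠ 1 := complexConj_restrictScalars_ne_one
  have hc2 : c * c = 1 := complexConj_mul_self
  rcases ker_thin_of_mem_zpowers hcard hc1 hc2 hcz hidx χ hχ with hker | ⟨ν, hν1, hχν, hker⟩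
  · exact not_equidistributed_of_ker_trivial hT χ hχ hker hE
  · obtain ⟨hv1, hv⟩ := forall_mem_iff_of_ker_pair hT (hcomm c ν) χ hχ hν1 hχν hker hE
    refine not_isPrimitive_of_forall_mem_iff Φ φ₀ hv1 (fun w => ?_) hprim
    rw [← hmemT, ← hmemT]
    exact hv w

end Field

end Summit.HodgeConjecture.CorCM.ThinKernel

end
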